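import Mathlib
import HarnessLib
import Summits.Ventures.LatticeQCDFlow.Scoring.SU3TraceModulusCentre
import Summits.Ventures.LatticeQCDFlow.Scoring.SU3TracelessOrderThree

/-!
# The centre-blind combination `|tr U|² − 1` on `SU(3)`: range `[−1, 8]`, `= 8` exactly on the centre, `= −1` exactly on the traceless (order-three) class, and invariance under `U ↦ ζU`

HONEST FRAMING: exact (Metropolis-corrected) sampling algorithms for lattice gauge theory;
figures of merit are autocorrelation/cost numbers at stated couplings and volumes; no
continuum-physics claim.

Venture `LatticeQCDFlow` (cell pub-lqcd), sub-topic `Scoring`; FANOUT row 21 (`su3-base`: the 4D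
`SU(3)` baselines).  NEW WORK of the cell (placement rule), elementary, joining row 21 GEN-8's
`Scoring/SU3TraceModulusCentre` (`|tr U| ≤ 3`, `= 3 ⇔` centre) and `Scoring/SU3TracelessOrderThree`
(`tr U = 0 ⟹ U³ = 1`, not central).  No definition is introduced; nothing is cited as a fact; no
number of ours.  NAMED ONLY: `|tr U|² − 1` is the character of the adjoint representation of
`SU(3)` (`3 ⊗ 3̄ = 8 ⊕ 1`); adjoint Wilson/Polyakov loops are blind to the centre `Z₃`.

## What is proved (`U ∈ SU(3)`)

* **`su3_normSq_trace_sub_one_mem_Icc`** — `−1 ≤ |tr U|² − 1 ≤ 8`;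
* **`su3_normSq_trace_sub_one_eq_eight_iff`** — `= 8 ⇔ U = ζ·1`, `ζ³ = 1` (the centre);
* **`su3_normSq_trace_sub_one_eq_neg_one_iff`** — `= −1 ⇔ tr U = 0`, and then `U³ = 1` and `U` is
  not central (`su3_pow_three_of_normSq_trace_sub_one_eq_neg_one`);
* centre blindness: `normSq_trace_smul_of_norm_eq_one` — `|tr (ζ • U)|² = |tr U|²` for `|ζ| = 1`;
  `su3_centre_smul_mem` — `ζ • U ∈ SU(3)` for `ζ³ = 1` (the `Z₃` action on links), so the quantity
  takes the same value on `U` and on its centre translates (`su3_normSq_trace_sub_one_centre_smul`),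
  while the fundamental trace is rotated (`tr(ζU) = ζ tr U`, Mathlib's `Matrix.trace_smul`).

NOT CLAIMED: any representation-theoretic statement (that this IS the adjoint character is named,
not proved); anything about centre-sector dynamics; anything for `N ≠ 3`.
-/

namespace Summit.Ventures.LatticeQCDFlow.Scoring

open Matrix Complex
open Literature.MathematicalPhysics.QuantumLattice

section SpecialUnitaryThree

/-- **`−1 ≤ |tr U|² − 1 ≤ 8` on `SU(3)`.** -/
theorem su3_normSq_trace_sub_one_mem_Icc (U : Matrix.specialUnitaryGroup (Fin 3) ℂ) :
    ‖(U : Matrix (Fin 3) (Fin 3) ℂ).trace‖ ^ 2 - 1 ∈ Set.Icc (-1 : ℝ) 8 := by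
  have h := su3_norm_trace_le U
  have h0 := norm_nonneg ((U : Matrix (Fin 3) (Fin 3) ℂ).trace)
  constructor
  · nlinarith
  · nlinarith

/-- **`|tr U|² − 1 = 8` iff `U` is central.** -/
theorem su3_normSq_trace_sub_one_eq_eight_iff (U : Matrix.specialUnitaryGroup (Fin 3) ℂ) :
    ‖(U : Matrix (Fin 3) (Fin 3) ℂ).trace‖ ^ 2 - 1 = 8 ↔
      ∃ ζ : ℂ, ζ ^ 3 = 1 ∧ (U : Matrix (Fin 3) (Fin 3) ℂ) = ζ • (1 : Matrix (Fin 3) (Fin 3) ℂ) := by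
  rw [← su3_norm_trace_eq_three_iff]
  have h0 := norm_nonneg ((U : Matrix (Fin 3) (Fin 3) ℂ).trace)
  constructor
  · intro h
    nlinarith [su3_norm_trace_le U]
  · intro h
    rw [h]; norm_num

/-- **`|tr U|² − 1 = −1` iff `tr U = 0`.** -/
theorem su3_normSq_trace_sub_one_eq_neg_one_iff (U : Matrix.specialUnitaryGroup (Fin 3) ℂ) :
    ‖(U : Matrix (Fin 3) (Fin 3) ℂ).trace‖ ^ 2 - 1 = -1 ↔ (U : Matrix (Fin 3) (Fin 3) ℂ).trace = 0 := by
  rw [sub_eq_neg_self, sq_eq_zero_iff, norm_eq_zero]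

/-- At the minimum the link has order three and is not central. -/
theorem su3_pow_three_of_normSq_trace_sub_one_eq_neg_one (U : Matrix.specialUnitaryGroup (Fin 3) ℂ)
    (h : ‖(U : Matrix (Fin 3) (Fin 3) ℂ).trace‖ ^ 2 - 1 = -1) :
    U ^ 3 = 1 ∧
      ¬ ∃ ζ : ℂ, ζ ^ 3 = 1 ∧ (U : Matrix (Fin 3) (Fin 3) ℂ) = ζ • (1 : Matrix (Fin 3) (Fin 3) ℂ) := by
  have ht := (su3_normSq_trace_sub_one_eq_neg_one_iff U).mp h
  exact ⟨su3_pow_three_eq_one_of_trace_eq_zero U ht, su3_trace_eq_zero_not_central U ht⟩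

/-! ### Centre blindness -/

/-- **`|tr (ζ • U)|² = |tr U|²` for unimodular `ζ`**: the quantity `|tr|² − 1` cannot see the centre. -/
theorem normSq_trace_smul_of_norm_eq_one {ζ : ℂ} (hζ : ‖ζ‖ = 1) (M : Matrix (Fin 3) (Fin 3) ℂ) :
    ‖(ζ • M).trace‖ ^ 2 = ‖M.trace‖ ^ 2 := by
  rw [Matrix.trace_smul, smul_eq_mul, norm_mul, hζ, one_mul]

/-- The `Z₃` action on links: `ζ • U ∈ SU(3)` for `U ∈ SU(3)` and `ζ³ = 1`. -/
theorem su3_centre_smul_mem {ζ : ℂ} (hζ : ζ ^ 3 = 1) (U : Matrix.specialUnitaryGroup (Fin 3) ℂ) :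
    ζ • (U : Matrix (Fin 3) (Fin 3) ℂ) ∈ Matrix.specialUnitaryGroup (Fin 3) ℂ := by
  have hn : ‖ζ‖ = 1 := by
    have h : ‖ζ‖ ^ 3 = 1 := by rw [← norm_pow, hζ, norm_one]
    exact (pow_eq_one_iff_of_nonneg (norm_nonneg ζ) (by norm_num)).mp h
  have hζζ : (starRingEnd ℂ) ζ * ζ = 1 := by
    rw [← Complex.normSq_eq_conj_mul_self, Complex.normSq_eq_norm_sq, hn]; norm_num
  rw [Matrix.mem_specialUnitaryGroup_iff]
  refine ⟨?_, ?_⟩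
  · rw [Matrix.mem_unitaryGroup_iff']
    rw [star_smul, Matrix.smul_mul, Matrix.mul_smul, Unitary.star_mul_self_of_mem U.2.1, smul_smul,
      Complex.star_def, hζζ, one_smul]
  · rw [det_smul, Fintype.card_fin, hζ, one_mul]
    exact (Matrix.mem_specialUnitaryGroup_iff.mp U.2).2

/-- A unimodular cube root acts on the fundamental trace by rotation but leaves `|tr|² − 1` fixed:
the centre translates `U, ζU, ζ²U` share the value of the centre-blind quantity. -/
theorem su3_normSq_trace_sub_one_centre_smul {ζ : ℂ} (hζ : ζ ^ 3 = 1)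
    (U : Matrix.specialUnitaryGroup (Fin 3) ℂ) :
    ‖(ζ • (U : Matrix (Fin 3) (Fin 3) ℂ)).trace‖ ^ 2 - 1 = ‖(U : Matrix (Fin 3) (Fin 3) ℂ).trace‖ ^ 2 - 1 := by
  have hn : ‖ζ‖ = 1 := by
    have h : ‖ζ‖ ^ 3 = 1 := by rw [← norm_pow, hζ, norm_one]
    exact (pow_eq_one_iff_of_nonneg (norm_nonneg ζ) (by norm_num)).mp h
  rw [normSq_trace_smul_of_norm_eq_one hn]

end SpecialUnitaryThree

end Summit.Ventures.LatticeQCDFlow.Scoring
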